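import Mathlib
import HarnessLib
import Summits.ResolutionOfSingularities.ResolutionOfSingularities.Theorems.WildQuotientsWildQuotientResolutionS1aModelNodeCentre
import Summits.ResolutionOfSingularities.ResolutionOfSingularities.Theorems.WildQuotientsWildQuotientResolutionS1aKillCertCoverEq
import Summits.ResolutionOfSingularities.ResolutionOfSingularities.Theorems.WildQuotientsWildQuotientResolutionS1aKillPowerChains
import Summits.ResolutionOfSingularities.ResolutionOfSingularities.Theorems.WildQuotientsWildQuotientResolutionS1aAuxOfRingData

/-!
# S1a — A PRINCIPAL CENTRE FROM A NODE CHART OF POWER-CHAIN TYPE (the member producer of the parallel kill leaf)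

[OURS · L1 W4.5c · lead-1 g14; plan-1 RULING R-F15k (b3)/(b4): the per-component input of ★`killsIn_one_of_disjointPrincipalFamily` (`…S1aKillLeafFamily`) for the
line-arrangement class L_d] — NOT statements of the manuscript; counted 0; AI-level work, weaker than expert review. Crux stmt-ResolutionOfSingularities-17941
`CyclicQuotientFourfolds`, line `s1a-logminvertex` v13 (`stub_reachLowerInFX`).

Same data as ✓`killsIn_one_of_modelNodePowerChains` (`…S1aModelNodeKill`: chart `W` of a separated model with node `DW` and free model `Φ : DW.B ≃ k[T_ι][1/h]`,
distinct centre variables with weights, transported automorphism `conj Φ σ` of POWER-CHAIN TYPE with shift for a boundary `β`), but with the Veronese degree `d`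
GIVEN (so that several members can share one) and only the degree-`d` trace required closed; output: a PRINCIPAL centre `J` on `M` of degree `d` with `W` a
principal-centre chart, support `⊆` the closure of the trace zero set, and the trace formula on `W`.
* ★★ `exists_isPrincipalCentre_of_modelNodePowerChains` — KC3_δ∘KC5_δ ✓`cobordantKillCert_of_powerChains_shift` in the free model, KC1′
  ✓`isPrincipal_augmentationIdeal_sigmaChart_of_cert`, the chart filtration ✓`chartFiltration`, and ✓`exists_isPrincipalCentre_of_agree_filtration_eq` (one chart).
-/

set_option linter.dupNamespace false

noncomputable section

open CategoryTheory Limits AlgebraicGeometry TopologicalSpace Topology Opposite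
open Literature.AlgebraicGeometry.Resolution Literature.AlgebraicGeometry.RelativeSpec
open MvPolynomial
open Summit.ResolutionOfSingularities.ResolutionOfSingularities.Theorems.WildQuotientResolution.S1
open Summit.ResolutionOfSingularities.ResolutionOfSingularities.Theorems.WildQuotientResolution.S1.NodeAtlas
open Summit.ResolutionOfSingularities.ResolutionOfSingularities.Theorems.WildQuotientResolution.S1.ProducerStep
open Summit.ResolutionOfSingularities.ResolutionOfSingularities.Theorems.WildQuotientResolution.S1.CoarseChart
open Summit.ResolutionOfSingularities.ResolutionOfSingularities.Theorems.WildQuotientResolution.S1.ChartData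
open Summit.ResolutionOfSingularities.ResolutionOfSingularities.Theorems.WildQuotientResolution.S1.GoodCharts
open Summit.ResolutionOfSingularities.ResolutionOfSingularities.Theorems.WildQuotientResolution.S1.KillableTransport
open Summit.ResolutionOfSingularities.ResolutionOfSingularities.Theorems.WildQuotientResolution.S1.NodeTransport
open Summit.ResolutionOfSingularities.ResolutionOfSingularities.Theorems.WildQuotientResolution.S1.NpFrame
open Summit.ResolutionOfSingularities.ResolutionOfSingularities.Theorems.WildQuotientResolution.S1.KillCert
open Summit.ResolutionOfSingularities.ResolutionOfSingularities.Theorems.WildQuotientResolution.S1.ModelNode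
open Summit.ResolutionOfSingularities.ResolutionOfSingularities.Theorems.WildQuotientResolution.S1.ExtendRees
open Summit.ResolutionOfSingularities.ResolutionOfSingularities.Theorems.WildQuotientResolution.S1.KillGlue

namespace Summit.ResolutionOfSingularities.ResolutionOfSingularities.Theorems.WildQuotientResolution.S1.GameFrame.GModel

variable {p : ℕ} {X' X₁ : Scheme.{0}} {q : X' ⟶ X₁} {G : Type} [Group G] {ρ : G →* Aut X'} {g₀ : G}

/-- ★★ **A PRINCIPAL CENTRE FROM A NODE CHART OF POWER-CHAIN TYPE.** `M` separated, `W` a stable affine chart with node `DW` and free model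
`Φ : DW.B ≃ k[T_ι][1/h]`; distinct centre variables `T_{v i}` (`c > 0`, homogeneous, weights `w > 0`, missing `h = 0` at a point) Veronese-normalised at the GIVEN
degree `d > 0`, with the degree-`d` trace zero set closed in `M.V` inside `W`; the transported automorphism (a′)_δ-admissible for a boundary `β`, isolated, of
POWER-CHAIN TYPE. Then there is a PRINCIPAL centre `J` on `M` of Veronese degree `d` for which `W` is a principal-centre chart, whose support lies in the closure
of the trace zero set, and whose filtration on `W` is the trace. [OURS · L1 W4.5c · R-F15k (b4) member producer; NOT a statement of the manuscript] -/
theorem exists_isPrincipalCentre_of_modelNodePowerChains [Finite G] (hG : ∀ g : G, g ∈ Subgroup.zpowers g₀) (M : GModel p q G ρ g₀)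
    [M.V.IsSeparated] (W : M.act.StableAffineOpens) (DW : NodeData p M.act g₀ W)
    {k : Type} [Field k] {ι : Type} [Finite ι] (hh : MvPolynomial ι k) (Φ : letI := DW.instCommRing; DW.B ≃+* Localization.Away hh)
    {c : ℕ} (hc : 0 < c) (v : Fin c → ι) (hv : Function.Injective v) (δ : Fin c → Π j : Fin DW.m, ZMod (DW.r j)) (w : Fin c → ℕ) (hw : ∀ i, 0 < w i)
    (hdeg : ∀ i, letI := DW.instCommRing; letI := DW.instGradedRing;
      algebraMap (MvPolynomial ι k) (Localization.Away hh) (X (v i)) ∈ mapGrading DW.𝒜 Φ (δ i))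
    (g : ι → k) (hg : ∀ i, g (v i) = 0) (hu : MvPolynomial.eval g hh ≠ 0)
    (d : ℕ) (hd : 0 < d)
    (hver : letI := DW.instCommRing; letI := DW.instGradedRing; letI := mapGradedRing DW.𝒜 Φ;
      VeroneseNormalised (mapGrading DW.𝒜 Φ) (fun i => algebraMap (MvPolynomial ι k) (Localization.Away hh) (X (v i))) w d)
    (β : Localization.Away hh) (sh : ℕ)
    (hadm : letI := DW.instCommRing; ∀ (n : ℕ) (z : Localization.Away hh),
      z ∈ (weightedFiltration (fun i => algebraMap (MvPolynomial ι k) (Localization.Away hh) (X (v i))) w).ideal n →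
        conj Φ DW.σ z - z ∈ Ideal.span {β} * (weightedFiltration (fun i => algebraMap (MvPolynomial ι k) (Localization.Away hh) (X (v i))) w).ideal (n + sh))
    (hiso : letI := DW.instCommRing; ∃ N : ℕ, Ideal.span (Set.range fun i => algebraMap (MvPolynomial ι k) (Localization.Away hh) (X (v i))) ^ N ≤
      (augmentationIdeal (conj Φ DW.σ)).colon (Ideal.span {β}))
    (hchain : letI := DW.instCommRing; ∀ i, ∃ (mm : ℕ) (u hunit : Localization.Away hh), 0 < mm ∧ sh ≤ mm * w i ∧ IsUnit hunit ∧
      u ∈ (weightedFiltration (fun i => algebraMap (MvPolynomial ι k) (Localization.Away hh) (X (v i))) w).ideal (mm * w i - sh) ∧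
      conj Φ DW.σ u - u - β * hunit * algebraMap (MvPolynomial ι k) (Localization.Away hh) (X (v i)) ^ mm ∈
        Ideal.span {β} * (weightedFiltration (fun i => algebraMap (MvPolynomial ι k) (Localization.Away hh) (X (v i))) w).ideal (mm * w i + 1))
    (hcl : letI := DW.instCommRing; letI := DW.instGradedRing; letI := mapGradedRing DW.𝒜 Φ;
      closure (M.V.zeroLocus (U := W.1)
          ((((traceFiltration (mapGrading DW.𝒜 Φ) (fun i => algebraMap (MvPolynomial ι k) (Localization.Away hh) (X (v i))) w).ideal d).comap
              ((DW.e.trans (zeroRingEquiv DW.𝒜 Φ) : Γ(M.V, W.1) ≃+* ↥(mapGrading DW.𝒜 Φ 0)) : Γ(M.V, W.1) →+* ↥(mapGrading DW.𝒜 Φ 0)) :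
            Ideal Γ(M.V, W.1)) : Set Γ(M.V, W.1)) ∩ (W.1 : Set M.V)) ⊆ (W.1 : Set M.V)) :
    letI := DW.instCommRing; letI := DW.instGradedRing; letI := mapGradedRing DW.𝒜 Φ
    ∃ J : ReesFiltration M.V, IsPrincipalCentre p M.act g₀ J d ∧ IsPrincipalCentreChart p M.act g₀ J d W ∧
      (((J.ideal d).support : Set M.V)) ⊆ closure (M.V.zeroLocus (U := W.1)
          ((((traceFiltration (mapGrading DW.𝒜 Φ) (fun i => algebraMap (MvPolynomial ι k) (Localization.Away hh) (X (v i))) w).ideal d).comap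
              ((DW.e.trans (zeroRingEquiv DW.𝒜 Φ) : Γ(M.V, W.1) ≃+* ↥(mapGrading DW.𝒜 Φ 0)) : Γ(M.V, W.1) →+* ↥(mapGrading DW.𝒜 Φ 0)) :
            Ideal Γ(M.V, W.1)) : Set Γ(M.V, W.1)) ∩ (W.1 : Set M.V)) ∧
      ∀ n, (J.filtration ⟨W.1, DW.affine⟩).ideal n =
        ((traceFiltration (mapGrading DW.𝒜 Φ) (fun i => algebraMap (MvPolynomial ι k) (Localization.Away hh) (X (v i))) w).ideal n).comap
          ((DW.e.trans (zeroRingEquiv DW.𝒜 Φ) : Γ(M.V, W.1) ≃+* ↥(mapGrading DW.𝒜 Φ 0)) : Γ(M.V, W.1) →+* ↥(mapGrading DW.𝒜 Φ 0)) := by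
  classical
  letI := DW.instCommRing
  letI := DW.instGradedRing
  letI := mapGradedRing DW.𝒜 Φ
  haveI : IsLocallyNoetherian M.V := M.isLocallyNoetherian
  set f : Fin c → Localization.Away hh := fun i => algebraMap (MvPolynomial ι k) (Localization.Away hh) (X (v i)) with hfdef
  set eL : Γ(M.V, W.1) ≃+* ↥(mapGrading DW.𝒜 Φ 0) := DW.e.trans (zeroRingEquiv DW.𝒜 Φ) with heL
  -- the transported node and K1′
  have htame : IsTameNode p (Localization.Away hh) (mapGrading DW.𝒜 Φ) (conj Φ DW.σ) := isTameNode_map DW.𝒜 Φ p DW.σ DW.tame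
  have hσ : ∀ t : Γ(M.V, W.1), ((eL ((M.act.aut g₀⁻¹).hom.appLE W.1 W.1 (W.2.1 g₀⁻¹).ge t) : ↥(mapGrading DW.𝒜 Φ 0)) : Localization.Away hh) =
      conj Φ DW.σ ((eL t : ↥(mapGrading DW.𝒜 Φ 0)) : Localization.Away hh) := fun t => by
    change Φ ((DW.e (actO M.act W g₀ t) : ↥(DW.𝒜 0)) : DW.B) = Φ (DW.σ (Φ.symm (Φ ((DW.e t : ↥(DW.𝒜 0)) : DW.B))))
    rw [DW.intertwine t, Φ.symm_apply_apply]
  have hK1 : RingTheory.Sequence.IsRegular (Localization.Away hh) (List.ofFn f) := isRegular_algebraMap_X_away k hh v hv g hg hu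
  have hK1' : IsRegularRing (Localization.Away hh ⧸ Ideal.span (Set.range f)) := isRegularRing_quotient_X_away k hh v
  have hσJ : ∀ n : ℕ, ((weightedFiltration f w).ideal n).map (conj Φ DW.σ : Localization.Away hh →+* Localization.Away hh) ≤
      (weightedFiltration f w).ideal n := map_le_of_admissible_shift f w (conj Φ DW.σ) sh β hadm
  -- the kill clause on every σ-fixed chart, from the power-chain certificate (KC1′)
  have hkill : ∀ (hp' : 0 < p) (hσp' : ∀ x : Localization.Away hh, (⇑(conj Φ DW.σ))^[p] x = x) (d' : ℕ) (b : ↥(mapGrading DW.𝒜 Φ 0))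
      (hb : b ∈ (traceFiltration (mapGrading DW.𝒜 Φ) f w).ideal d') (hσb : conj Φ DW.σ (b : Localization.Away hh) = b), 0 < d' →
      (augmentationIdeal (sigmaChart (mapGrading DW.𝒜 Φ) f w d' b hb (conj Φ DW.σ) hσJ hp' hσp' hσb)).IsPrincipal :=
    fun hp' hσp' d' b hb hσb hd' =>
      isPrincipal_augmentationIdeal_sigmaChart_of_cert f w (conj Φ DW.σ) hσJ hp' hσp' (mapGrading DW.𝒜 Φ) hd' b hb hσb
        (cobordantKillCert_of_powerChains_shift f w (conj Φ DW.σ) hσJ hp' hσp' sh β hadm hiso hchain)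
  -- the chart filtration of the trace: `W` is a principal-centre chart for it
  let K : IdealFiltration Γ(M.V, W.1) := (traceFiltration (mapGrading DW.𝒜 Φ) f w).comap (eL : Γ(M.V, W.1) →+* ↥(mapGrading DW.𝒜 Φ 0))
  let 𝒦₀ : ReesFiltration M.V := chartFiltration W.1 K
  have h𝒦₀O : ∀ n, (𝒦₀.filtration ⟨W.1, DW.affine⟩).ideal n =
      ((traceFiltration (mapGrading DW.𝒜 Φ) f w).ideal n).comap (eL : Γ(M.V, W.1) →+* ↥(mapGrading DW.𝒜 Φ 0)) := fun n => by
    rw [filtration_chartFiltration W.1 DW.affine K n]; rfl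
  have hprin₀ : IsPrincipalCentreChart p M.act g₀ 𝒦₀ d W :=
    ⟨DW.affine, DW.m, DW.r, Localization.Away hh, inferInstance, mapGrading DW.𝒜 Φ, inferInstance, conj Φ DW.σ, eL, htame, hσ, c, f, δ, w, hc, hdeg, hw,
      hK1, hK1', hσJ, h𝒦₀O, hver, hkill⟩
  -- support = closure of the trace zero set, closed and inside `W`
  have hsupp : (((𝒦₀.ideal d).support : Set M.V)) = closure (M.V.zeroLocus (U := W.1) ((K.ideal d : Ideal Γ(M.V, W.1)) : Set Γ(M.V, W.1)) ∩ (W.1 : Set M.V)) :=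
    support_chartFiltration W.1 DW.affine K d
  obtain ⟨J, hJ, hJsupp, hJW, hJfil⟩ := exists_isPrincipalCentre_of_agree_filtration_eq hG M (ι := Unit) (fun _ => W) (fun _ => DW.affine) (fun _ => 𝒦₀) hd
    (fun _ => hprin₀) (fun _ _ _ _ _ _ => rfl)
    (B := closure (M.V.zeroLocus (U := W.1) ((K.ideal d : Ideal Γ(M.V, W.1)) : Set Γ(M.V, W.1)) ∩ (W.1 : Set M.V))) isClosed_closure
    (by rw [Set.iUnion_const]; exact hcl) (fun _ => by rw [hsupp]; exact Set.inter_subset_left)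
  exact ⟨J, hJ, hJW (), hJsupp, fun n => by rw [hJfil () n, h𝒦₀O]⟩

end Summit.ResolutionOfSingularities.ResolutionOfSingularities.Theorems.WildQuotientResolution.S1.GameFrame.GModel

end
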